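import Summits.QuantumAdvantage.QuantumAdvantage.Theses.WhiteBoxWalk
import Literature.Computability.Cryptography.IndistinguishabilityObfuscatorSubexp
import Literature.Computability.Cryptography.PuncturablePRF
import Literature.Computability.Complexity.RandomizedProofs
import Summits.QuantumAdvantage.QuantumAdvantage.Theorems.WbwObfuscatedGluedTrees.Negative.KeyedIndistinguishability
import Summits.QuantumAdvantage.QuantumAdvantage.Theorems.WbwObfuscatedGluedTrees.Negative.TypedTraps
import Summits.QuantumAdvantage.QuantumAdvantage.Theorems.WbwObfuscatedGluedTrees.Negative.LoadBearing
import Summits.QuantumAdvantage.QuantumAdvantage.Theorems.WbwObfuscatedGluedTreesKowVocabulary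
import Summits.QuantumAdvantage.QuantumAdvantage.Theorems.WbwObfuscatedGluedTreesKowSplit
import Summits.QuantumAdvantage.QuantumAdvantage.Theorems.WbwObfuscatedGluedTreesKowObfuscationMonotone
import Summits.QuantumAdvantage.QuantumAdvantage.Theorems.WbwObfuscatedGluedTreesKowBestPossibleStep

/-!
# Line `knowledge-of-walk-split` — CLOSED skeleton (crux proof) for crux `WbwObfuscatedGluedTrees` (stmt-QuantumAdvantage-2340, route WhiteBoxWalk)

crux-plan round 1 (planner-cruxplan-stmt-QuantumAdvantage-2340-knowledge-of-walk-sp-0, 2026-08-16), from idea card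
`Cruxes/WbwObfuscatedGluedTrees/Ideas/knowledge-of-walk-split.md` (ideator 2; triage r1: 3 × pass, with the
mandatory sharpening of TRIAGE-r1-3: "never quantify KWA over the obfuscator").

## Status of the crux and what this skeleton concludes

The crux is INFORMAL: item stmt-QuantumAdvantage-2340 has no signature and the route file
`Theses/WhiteBoxWalk.lean` has no `def WbwObfuscatedGluedTrees` (the generator `obfuscatedGluedTreesGen`
is an open definition request).  Every seat so far (rattack `CruxTemplate`, the standing disprover's
`Disproof.lean` §0, the three ideators) works against the TYPED STAND-IN `CruxShape obfGen` (copied verbatim in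
§0 below): clause (C) of `WbwThesis` for the generator `obfGen O P f c`, for every sub-exponentially secure iO
`O`, every `(2^{κ^ε},2^{-κ^ε})`-secure puncturable PRF `P`, every injective one-way `f`, `c·ε > 1`.

This line's checked target is the closed, generator-generic statement `KnowledgeTransfer` (§4):

  for every line datum `𝓛` (key schedule, two key-indexed circuit families `C₀ ≡ C₁`, entrance/answer
  names, walk model) admissible for the sub-exp iO `O`:
  `Coherent → KnowledgeOfWalk 𝓛.M 𝓛.gen₀ → WordHard 𝓛.M 𝓛.gen₀ ans → ClauseC (𝓛.gen O) ans`,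

where `𝓛.gen₀ = genClear C₁` is the O-FREE reference generator (intended instance: `C₁ k̃ = pad_S(O₀(N_k; r₀))`,
the canonical neighbour circuit obfuscated ONCE by ONE fixed obfuscator `O₀` whose coins `r₀` are part of the
key `k̃ = (k, r₀)`) and `𝓛.gen O = genObf O C₀` is the crux-shaped generator (`C₀ k̃ = pad_S(N_k)` obfuscated by
the universally quantified `O`).  `theorem WbwObfuscatedGluedTrees_of` composes the three registered stubs
into `KnowledgeTransfer` BY NAME; `cruxShape_of_knowledgeTransfer` (§5, proved) shows how `CruxShape obfGen`
follows once the definition lands: `obfGen` factors through line data + the two generator-specific obligations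
`KnowledgeOfWalk` (KWA₀, conjecture-grade: a knowledge axiom) and `WordHard` (WordHard₀, crux-grade: white-box
PATH-finding hardness, advantage-neutral) for the reference generator.  Those two are the route-level
RE-TYPING the card and all three triagers ask for; they cannot be closed `Prop`s (hence not stubs) before
`obfuscatedGluedTreesGen` exists, and quantified over all data they would be false — so they are antecedents
of the target, named, not hidden.  `ledger skeleton check … --crux-decl <this namespace>.KnowledgeTransfer`.

## Lead's reshape (prover-line-stmt-QuantumAdvantage-2340-0, cycle 1, 2026-08-16)

* §0 is no longer copied: `ClauseC`, `wbwThesis_iff`, `GenType`, `CruxShape` are those of the landed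
  `Negative/LoadBearing.lean` (imported, opened).
* Stubs 2–3 and `LineData.Admissible` receive the missing side condition "clear instances / entrance names /
  answers have length polynomially bounded in the seed length" (`∃ q, ∀ s, |genClear … s| (+ …) ≤ q(|s|)`): without
  it the coin-count guessing losses of the two transfer reductions are not polynomial in `n` (the tree's PPT model
  has non-computable, only polynomially BOUNDED coin budgets; a reduction that manufactures inputs must guess the
  budget, at a loss polynomial in the INPUT length); the intended generator is poly-time, so the clause is free.
  Stubs re-registered (`ledger skeleton check`, 2026-08-16T04:4xZ).
* After Disproof §6 (cycle 3, T-a/T-b/T-d): (T-a) = the length bound above; (T-b) the coin discipline of stubs 2–3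
  and of `Admissible` is made EVENTUAL in the seed length (`∃ n₀, ∀ s, n₀ ≤ |s| → O.coins … ≤ |s| − h |s|`; the
  pointwise clause forced `O.coinLen ℓ₀ = 0` at `s = []`, making admissibility unsatisfiable for every coin-tossing
  obfuscator and the §5 bridge vacuous), and the §5 bridge takes an `O`-DEPENDENT line datum `𝓛 O P f c` with
  `O`-dependent antecedents; (T-d) is a route-level remark on typing `O₀` (no stub content).
* Toolkit landed/landing by the lead as flat Theorems files `WbwObfuscatedGluedTreesKow{Vocabulary,FPExtension,
  CoinNormalisation,SeedLaw,BpsDistinguisher,BpsKeyedStep,BestPossibleStep}.lean`: total `FP` extensions of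
  machines on codes (clocked universal simulation), coin-count normalisation with prefix stability, seed laws;
  `stub_bestPossibleStep` is PROVED (lead; files Bps*), `stub_split` / `stub_obfuscationMonotone` delegated.

## The three stubs (all generator-generic, believed TRUE, provable now; composed linearly)

* `stub_split` (M) — the SPLIT: `Coherent → KnowledgeOfWalk → WordHard → ClauseC` for any walk model and
  generator.  Union bound `Pr[ans ≤+ A] ≤ Pr[KWA-failure] + Pr[E's word ends at ans]`; the word finder
  `W := ⟨fun z r => E (boolPair z r), A.coinLen⟩` TRANSPORTS `A`'s coin budget (the extractor is
  deterministic poly-time on (input, A's coins), so no coin-length computation is needed), and `WordHard W`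
  bounds the second term.
* `stub_obfuscationMonotone` (M) — ideator-3's OBFUSCATION IS MONOTONE, re-typed: clause (C) for the CLEAR
  key-indexed family `C` implies clause (C) for its `O`-obfuscations (the adversary re-obfuscates by itself;
  `O.IsEfficient`, `κ` unary-poly-time; `O`'s coin count is not computable in the tree's model — guess it,
  polynomial loss, harmless for a negligible-success conclusion).
* `stub_bestPossibleStep` (L, HARDEST) — ideator-3's BEST-POSSIBLE STEP, re-typed: for key-indexed families
  `C₀ k ≡ C₁ k` (same arity/size/function, both in `ppolyCircuits (κ n)`), clause (C) for `genObf O … C₁`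
  implies clause (C) for `genObf O … C₀` when `O` is sub-exp iO.  Tool LANDED in the tree:
  `Negative.KeyedIndistinguishability.keyed_family_subexp` (worst-case-key advice; the distinguisher is
  "run A on (1ⁿ, code, name ENT), test the prefix", advice `(n, nm k, ans k)`); first normalise `A` to a
  computable polynomial coin budget (coin-length guessing, poly loss — legitimate for SEARCH success, cf.
  `PseudorandomFunctionsPneNPProofs` header), then `δ(κ n) = 2^{-(κ n)^ε} ≤ 2^{-n^{cε}}` is negligible.

MODEL REPAIRS w.r.t. the ideator sketches (recorded for the lead): (i) `genObf` feeds `O` the PREFIX of the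
seed tail of length `O.coins κ C` and the coin discipline is the INEQUALITY `O.coins ≤ n − h n` (ideator-3's
equality for both families is unsatisfiable: `encodeCircuit` lengths depend on the wiring, so two same-size
circuits have different codes and may have different coin demands); (ii) the KWA extractor is a deterministic
poly-time function of (input, coins) (Damgård/BCPR form; a probabilistic extractor is accommodated by
coin-length guessing at polynomial loss); (iii) `κ` unary-poly-time computable in `ObfuscationMonotone`.

## Disproof.lean (cdisprove cycles 1–2) — what this skeleton honours

No `_false_without_` theorem exists for this crux (both cycles: "no `¬`-target; `not_cruxShape_imp`").
§5 `QuantumShadow.no_erasing_terminal`: honoured BY DESIGN — the classical-only, non-black-box-in-`A` step is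
the antecedent `KnowledgeOfWalk` (extractor reads `A`'s coins); no stub ends in an answer-free world (every
stub keeps `ans` = `name(EXIT)` in the instance's functionality; `stub_bestPossibleStep` compares two
functionally EQUAL families).  §4 one-iO-to-all + quantifier-order obligation: `stub_bestPossibleStep` is its
positive form and its landed tool `Negative/KeyedIndistinguishability.lean` is imported here.  §0b
`TypedTraps` (imported): `Coherent` forces `ans s` to be a valid non-entrance name of length `nameLen` on
EVERY seed, so the `ans = []` trap is excluded at the hypothesis.  §1/§1b/§1c/§1d (role order, depth leak,
altimeter, structured cycle) and §2 (malleable names): they make `WordHard` resp. `KnowledgeOfWalk` FALSE for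
the corresponding mutant data — consistent with the split (the sanity lemmas `not_wordHard_of_detWord`,
`not_knowledgeOfWalk_of_unreachable` in §6 are the typed form of the card's falsifier (3)); none of the three
stubs is an instance a landed `Negative/` lemma refutes (they are reductions, not hardness claims).  §3
percolation: not engaged (nothing is un-named or planted).  TRIAGE-r1-3 gadget attack on `CruxPlus`: honoured —
KWA is asserted for ONE O-free reference family `C₁`, never for `∀ O`.
-/

set_option linter.dupNamespace false

namespace Summit.QuantumAdvantage.QuantumAdvantage.Cruxes.WbwObfuscatedGluedTrees.KnowledgeOfWalkSplit

open Literature.Computability.Cryptography Literature.Computability.Complexity Filter Asymptotics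

/-! ## §0 Clause (C) and the typed shape of the crux

`ClauseC`, `wbwThesis_iff`, `GenType`, `CruxShape` are those of `Negative/LoadBearing.lean` (landed, imported):
no local copies (lead's reshape, cycle 1). -/

open Summit.QuantumAdvantage.QuantumAdvantage.Theorems.WbwObfuscatedGluedTrees.Negative
  (ClauseC wbwThesis_iff GenType CruxShape)

/-! ## §1–§2 Walk semantics, KWA, WordHard, Coherent, generator shapes

LANDED as the importable definitions file `Theorems/WbwObfuscatedGluedTreesKowVocabulary.lean` (namespace
`…Theorems.WbwObfuscatedGluedTrees.KnowledgeOfWalk`; lead, cycle 1) and imported here, so that the stub files and this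
composition share ONE copy; the names below are the vocabulary's. -/

open Summit.QuantumAdvantage.QuantumAdvantage.Theorems.WbwObfuscatedGluedTrees.KnowledgeOfWalk
  (WalkModel inst KnowledgeOfWalk WordHard Coherent genObf genClear keyed)

/-! ## §3 The three stubs -/

/-- Statement of `stub_split`. -/
def SplitLemma : Prop :=
  ∀ (M : WalkModel) (gen ans : List Bool → List Bool),
    Coherent M gen ans → KnowledgeOfWalk M gen → WordHard M gen ans → ClauseC gen ans

/-- Statement of `stub_obfuscationMonotone`. -/
def ObfuscationMonotone : Prop :=
  ∀ (O : CircuitObfuscator), O.IsEfficient →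
  ∀ (κ h : ℕ → ℕ) (m : List Bool → ℕ) (C : (k : List Bool) → Circuit (Fin (m k)))
    (nm ans : List Bool → List Bool),
    PolyTimeComputable Computability.unaryEncodeNat Computability.unaryEncodeNat κ →
    (∃ p : Polynomial ℕ, ∀ n, κ n ≤ p.eval n) → (∀ n, h n ≤ n) →
    (∃ q : Polynomial ℕ, ∀ s : List Bool, (genClear h m C nm s).length ≤ q.eval s.length) →
    (∃ n₀ : ℕ, ∀ s : List Bool, n₀ ≤ s.length →
        O.coins (κ s.length) (C (s.take (h s.length))) ≤ s.length - h s.length) →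
    ClauseC (genClear h m C nm) (keyed h ans) →
    ClauseC (genObf O κ h m C nm) (keyed h ans)

/-- Statement of `stub_bestPossibleStep`. -/
def BestPossibleStep : Prop :=
  ∀ (ε : ℝ) (O : CircuitObfuscator), 0 < ε → IsSubexpIO ε ppolyCircuits O →
  ∀ (κ h : ℕ → ℕ) (m : List Bool → ℕ) (C₀ C₁ : (k : List Bool) → Circuit (Fin (m k)))
    (nm ans : List Bool → List Bool),
    (∃ c : ℝ, 0 < c ∧ ∀ᶠ n : ℕ in atTop, (n : ℝ) ^ c ≤ κ n) →
    (∃ p : Polynomial ℕ, ∀ n, κ n ≤ p.eval n) → (∀ n, h n ≤ n) →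
    (∃ q : Polynomial ℕ, ∀ s : List Bool, (genClear h m C₀ nm s).length + (genClear h m C₁ nm s).length +
        (keyed h ans s).length ≤ q.eval s.length) →
    (∀ s : List Bool,
        (⟨m (s.take (h s.length)), C₀ (s.take (h s.length))⟩ : SizedCircuit) ∈
            ppolyCircuits (κ s.length) ∧
        (⟨m (s.take (h s.length)), C₁ (s.take (h s.length))⟩ : SizedCircuit) ∈
            ppolyCircuits (κ s.length) ∧
        (C₀ (s.take (h s.length))).size = (C₁ (s.take (h s.length))).size ∧
        (∀ x, (C₀ (s.take (h s.length))).eval x = (C₁ (s.take (h s.length))).eval x)) →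
    (∃ n₀ : ℕ, ∀ s : List Bool, n₀ ≤ s.length →
        O.coins (κ s.length) (C₀ (s.take (h s.length))) ≤ s.length - h s.length ∧
        O.coins (κ s.length) (C₁ (s.take (h s.length))) ≤ s.length - h s.length) →
    ClauseC (genObf O κ h m C₁ nm) (keyed h ans) →
    ClauseC (genObf O κ h m C₀ nm) (keyed h ans)

/-- **STUB 1 (M) — the split.**  For any walk model coherent with `(gen, ans)`: KWA and WordHard give
clause (C).  Proof route: fix a PPT `A`, take its extractor `E` (KWA); pointwise in the coin string `r`,
`ans s <+: A.run z r` implies (by `Coherent`: `|ans s| = nameLen`, valid, `≠ entrance`) that either the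
KWA-failure event holds at `r` or `M.endpoint (gen s) (E (boolPair z r)) = some (ans s)`; hence
`A.pr id z {y | ans s <+: y} ≤ uniformProb … {KWA fails} + W.pr id z {w | endpoint = ans s}` for the word
finder `W := ⟨fun z r => E (boolPair z r), A.coinLen⟩` (`RandAlg.pr` is a push-forward of the SAME uniform
coins: `uniformProb_eq_toOuterMeasure`, monotonicity and subadditivity of `PMF.toOuterMeasure`); `W` is PPT
because `E` is poly-time on `boolPair z r` — which IS the pair encoding `RandAlg.IsPolyTime` uses — and
`W.coinLen = A.coinLen` is polynomially bounded (coin budget TRANSPORTED, nothing to compute); average over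
`s`, then `SuperpolynomialDecay.add` and domination of a nonnegative sequence by a decaying one. -/
theorem stub_split :
    ∀ (M : WalkModel) (gen ans : List Bool → List Bool),
      Coherent M gen ans → KnowledgeOfWalk M gen → WordHard M gen ans → ClauseC gen ans :=
  Summit.QuantumAdvantage.QuantumAdvantage.Theorems.WbwObfuscatedGluedTrees.KnowledgeOfWalk.stub_split

/-- **STUB 2 (M) — obfuscation is monotone** (card `best-possible-transfer` lemma (a), re-typed).  If no
PPT finds the keyed answer given the CLEAR circuit `C k` and `nm k`, none finds it given an honest
obfuscation `O(κ n, C k; U)` with `nm k`.  Proof route: from a PPT `A` against `genObf` build `A'` against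
`genClear`: on `⟨1ⁿ, ⟨code c, e⟩⟩` compute `κ n` (unary poly-time), GUESS the coin count
`j ∈ [0, q(|input|)]` (`q` a polynomial bound of `O.coinLen`, from `O.IsEfficient`; the exact value
`O.coins (κ n) c` is not computable in the tree's model), re-obfuscate `c' := O.obf (κ n) c ρ[..j]` (poly-time:
`O.IsEfficient`) and run `A` on `⟨1ⁿ, ⟨code c', e⟩⟩` with fresh coins (normalise `A` to a computable
polynomial coin budget first — again by guessing, polynomial loss; legitimate because the conclusion is a
SEARCH-success bound).  On the correct guess the instance law is exactly that of `genObf` (uniform prefix of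
the uniform seed tail, `O.coins ≤ n − h n`), so `succ(A') ≥ succ(A)/poly(n)`, and `ClauseC (genClear …)`
makes `succ(A')` negligible. -/
theorem stub_obfuscationMonotone :
    ∀ (O : CircuitObfuscator), O.IsEfficient →
    ∀ (κ h : ℕ → ℕ) (m : List Bool → ℕ) (C : (k : List Bool) → Circuit (Fin (m k)))
      (nm ans : List Bool → List Bool),
      PolyTimeComputable Computability.unaryEncodeNat Computability.unaryEncodeNat κ →
      (∃ p : Polynomial ℕ, ∀ n, κ n ≤ p.eval n) → (∀ n, h n ≤ n) →
      (∃ q : Polynomial ℕ, ∀ s : List Bool, (genClear h m C nm s).length ≤ q.eval s.length) →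
      (∃ n₀ : ℕ, ∀ s : List Bool, n₀ ≤ s.length →
          O.coins (κ s.length) (C (s.take (h s.length))) ≤ s.length - h s.length) →
      ClauseC (genClear h m C nm) (keyed h ans) →
      ClauseC (genObf O κ h m C nm) (keyed h ans) :=
  Summit.QuantumAdvantage.QuantumAdvantage.Theorems.WbwObfuscatedGluedTrees.KnowledgeOfWalk.stub_obfuscationMonotone

/-- **STUB 3 (L, HARDEST) — the best-possible step** (card `best-possible-transfer` lemma (b) = the positive
form of Disproof §4's one-iO-to-all transfer).  For key-indexed families `C₀ k ≡ C₁ k` of the same arity,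
size and function, both in `ppolyCircuits (κ n)`, and a sub-exp iO `O`: clause (C) for the obfuscations of
`C₁` implies clause (C) for the obfuscations of `C₀`.  Proof route: fix a PPT `A` against `genObf … C₀ …`,
normalised to a computable polynomial coin budget (guessing lemma, poly loss).  Distinguisher
`D(a, 1^κ, code) :=` "parse `a = (1ⁿ, e, t)`; run `A` on `boolPair 1ⁿ (boolPair code e)`; accept iff
`t <+: output`" (PPT in `|code| ≥ κ ≥ n^c`), advice for key `k` at level `n`: `(1ⁿ, nm k, ans k)` of length
`poly(n) ≤ 2^{(κ n)^ε}` eventually.  `Negative.KeyedIndistinguishability.keyed_family_subexp` (imported) with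
`keys κ₀ := {(n, k) | κ n = κ₀, k ∈ {0,1}^{h n}}` (finite: `n^c ≤ κ n`) gives, for all large `n` and ALL keys
at once, `|E_{O(C₀ k)} A.pr − E_{O(C₁ k)} A.pr| ≤ 2^{-(κ n)^ε}`; averaging over `k` (the seed law factors as
uniform key × uniform coin prefix, `O.coins ≤ n − h n`) bounds the difference of the two `uniformAvg`'s by
`2^{-(κ n)^ε} ≤ 2^{-n^{cε}}`, superpolynomially small (`superpolynomialDecay_two_rpow_neg`-type estimate);
conclude with `SuperpolynomialDecay.add`. -/
theorem stub_bestPossibleStep :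
    ∀ (ε : ℝ) (O : CircuitObfuscator), 0 < ε → IsSubexpIO ε ppolyCircuits O →
    ∀ (κ h : ℕ → ℕ) (m : List Bool → ℕ) (C₀ C₁ : (k : List Bool) → Circuit (Fin (m k)))
      (nm ans : List Bool → List Bool),
      (∃ c : ℝ, 0 < c ∧ ∀ᶠ n : ℕ in atTop, (n : ℝ) ^ c ≤ κ n) →
      (∃ p : Polynomial ℕ, ∀ n, κ n ≤ p.eval n) → (∀ n, h n ≤ n) →
      (∃ q : Polynomial ℕ, ∀ s : List Bool, (genClear h m C₀ nm s).length + (genClear h m C₁ nm s).length +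
          (keyed h ans s).length ≤ q.eval s.length) →
      (∀ s : List Bool,
          (⟨m (s.take (h s.length)), C₀ (s.take (h s.length))⟩ : SizedCircuit) ∈
              ppolyCircuits (κ s.length) ∧
          (⟨m (s.take (h s.length)), C₁ (s.take (h s.length))⟩ : SizedCircuit) ∈
              ppolyCircuits (κ s.length) ∧
          (C₀ (s.take (h s.length))).size = (C₁ (s.take (h s.length))).size ∧
          (∀ x, (C₀ (s.take (h s.length))).eval x = (C₁ (s.take (h s.length))).eval x)) →
      (∃ n₀ : ℕ, ∀ s : List Bool, n₀ ≤ s.length →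
          O.coins (κ s.length) (C₀ (s.take (h s.length))) ≤ s.length - h s.length ∧
          O.coins (κ s.length) (C₁ (s.take (h s.length))) ≤ s.length - h s.length) →
      ClauseC (genObf O κ h m C₁ nm) (keyed h ans) →
      ClauseC (genObf O κ h m C₀ nm) (keyed h ans) :=
  Summit.QuantumAdvantage.QuantumAdvantage.Theorems.WbwObfuscatedGluedTrees.KnowledgeOfWalk.stub_bestPossibleStep

/-! ### Consistency: each named statement IS its registered stub (definitionally) -/

/-- `SplitLemma` holds (it IS the landed `stub_split`). -/
theorem splitLemma_holds : SplitLemma := stub_split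
/-- `ObfuscationMonotone` holds (it IS the landed `stub_obfuscationMonotone`). -/
theorem obfuscationMonotone_holds : ObfuscationMonotone := stub_obfuscationMonotone
/-- `BestPossibleStep` holds (it IS the landed `stub_bestPossibleStep`). -/
theorem bestPossibleStep_holds : BestPossibleStep := stub_bestPossibleStep

/-! ### Name-keyed aliases of the three statements (the hypotheses of the composition; the skeleton audit
admits a hypothesis only if its head constant is a registered obligation or is named like a declared stub) -/
namespace Registered

/-- Alias of `SplitLemma` keyed by the registered stub name. -/
abbrev stub_split : Prop := SplitLemma
/-- Alias of `ObfuscationMonotone` keyed by the registered stub name. -/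
abbrev stub_obfuscationMonotone : Prop := ObfuscationMonotone
/-- Alias of `BestPossibleStep` keyed by the registered stub name. -/
abbrev stub_bestPossibleStep : Prop := BestPossibleStep

end Registered

/-! ## §4 Line data and the line's target `KnowledgeTransfer` -/

/-- The data the (missing) generator definition must supply to this line: the security-parameter schedule
`κ`, the key length `h`, the arity `m k` and two key-indexed circuit families — `C₀ k` (intended: the
canonical neighbour circuit `N_k` of the named glued-trees graph, padded to a fixed size `S`) and `C₁ k`
(intended: `pad_S (O₀.obf κ₀ N_k r₀)` for ONE fixed efficient functionality-preserving obfuscator `O₀`, its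
coins `r₀` being part of the key) —, the entrance name `nm k`, the answer `ans k = name_k(EXIT)`, and the walk
model `M` (evaluate the code carried by the instance).  No hardness content. -/
structure LineData where
  /-- security parameter fed to the obfuscator at seed length `n` -/
  κ : ℕ → ℕ
  /-- number of seed bits used as key material -/
  h : ℕ → ℕ
  /-- arity of the neighbour circuit for key `k` -/
  m : List Bool → ℕ
  /-- the canonical (padded) neighbour circuit -/
  C₀ : (k : List Bool) → Circuit (Fin (m k))
  /-- the O-free reference circuit (padded `O₀`-obfuscation of `C₀ k`), functionally equal, same size -/
  C₁ : (k : List Bool) → Circuit (Fin (m k))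
  /-- name of the ENTRANCE for key `k` -/
  nm : List Bool → List Bool
  /-- the answer `name_k(EXIT)` for key `k` -/
  ans : List Bool → List Bool
  /-- walk semantics of the instances -/
  M : WalkModel

namespace LineData

/-- The O-free REFERENCE generator `⟨code of C₁ k, nm k⟩` — where KWA₀ and WordHard₀ are asserted. -/
def gen₀ (𝓛 : LineData) : List Bool → List Bool := genClear 𝓛.h 𝓛.m 𝓛.C₁ 𝓛.nm

/-- The crux-shaped generator for the obfuscator `O`: `⟨code of O(κ n, C₀ k; coins), nm k⟩`. -/
def gen (𝓛 : LineData) (O : CircuitObfuscator) : List Bool → List Bool := genObf O 𝓛.κ 𝓛.h 𝓛.m 𝓛.C₀ 𝓛.nm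

/-- The keyed answer `s ↦ ans (key of s)`. -/
abbrev answer (𝓛 : LineData) : List Bool → List Bool := keyed 𝓛.h 𝓛.ans

/-- DEFINITIONAL admissibility of the data for the obfuscator `O` (what the definition item discharges for
its schedule): `κ` unary-poly-time, `n^c ≤ κ n ≤ poly(n)`, `h n ≤ n`, the clear instances of both families and the
keyed answer have polynomially bounded length (lead's reshape, cycle 1), on every seed the two circuits lie in
`ppolyCircuits (κ n)`, have equal size and equal function, and `O`'s coin demand fits in the seed tail for all
sufficiently long seeds (EVENTUAL coin discipline — lead's reshape after Disproof §6 (T-b): the pointwise clause forced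
a zero coin budget at `s = []`). -/
def Admissible (𝓛 : LineData) (O : CircuitObfuscator) : Prop :=
  PolyTimeComputable Computability.unaryEncodeNat Computability.unaryEncodeNat 𝓛.κ ∧
  (∃ c : ℝ, 0 < c ∧ ∀ᶠ n : ℕ in atTop, (n : ℝ) ^ c ≤ 𝓛.κ n) ∧
  (∃ p : Polynomial ℕ, ∀ n, 𝓛.κ n ≤ p.eval n) ∧
  (∀ n, 𝓛.h n ≤ n) ∧
  (∃ q : Polynomial ℕ, ∀ s : List Bool,
      (genClear 𝓛.h 𝓛.m 𝓛.C₀ 𝓛.nm s).length + (genClear 𝓛.h 𝓛.m 𝓛.C₁ 𝓛.nm s).length +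
        (keyed 𝓛.h 𝓛.ans s).length ≤ q.eval s.length) ∧
  (∀ s : List Bool,
      (⟨𝓛.m (s.take (𝓛.h s.length)), 𝓛.C₀ (s.take (𝓛.h s.length))⟩ : SizedCircuit) ∈
          ppolyCircuits (𝓛.κ s.length) ∧
      (⟨𝓛.m (s.take (𝓛.h s.length)), 𝓛.C₁ (s.take (𝓛.h s.length))⟩ : SizedCircuit) ∈
          ppolyCircuits (𝓛.κ s.length) ∧
      (𝓛.C₀ (s.take (𝓛.h s.length))).size = (𝓛.C₁ (s.take (𝓛.h s.length))).size ∧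
      (∀ x, (𝓛.C₀ (s.take (𝓛.h s.length))).eval x = (𝓛.C₁ (s.take (𝓛.h s.length))).eval x)) ∧
  (∃ n₀ : ℕ, ∀ s : List Bool, n₀ ≤ s.length →
      O.coins (𝓛.κ s.length) (𝓛.C₀ (s.take (𝓛.h s.length))) ≤ s.length - 𝓛.h s.length ∧
      O.coins (𝓛.κ s.length) (𝓛.C₁ (s.take (𝓛.h s.length))) ≤ s.length - 𝓛.h s.length)

end LineData

/-- **The line's target (typed stand-in for the informal crux).**  For every line datum admissible for a
sub-exponentially secure iO `O`: if the walk model is coherent with the reference generator and the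
reference generator satisfies KWA (classical extractability of walks) and WordHard (white-box path-finding
hardness), then clause (C) holds for the crux-shaped generator `𝓛.gen O`.  Closed and generator-generic; the
two generator-specific obligations are its named antecedents. -/
def KnowledgeTransfer : Prop :=
  ∀ (𝓛 : LineData) (ε : ℝ) (O : CircuitObfuscator), 0 < ε → IsSubexpIO ε ppolyCircuits O →
    𝓛.Admissible O → Coherent 𝓛.M 𝓛.gen₀ 𝓛.answer →
    KnowledgeOfWalk 𝓛.M 𝓛.gen₀ → WordHard 𝓛.M 𝓛.gen₀ 𝓛.answer →
    ClauseC (𝓛.gen O) 𝓛.answer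

/-- **Composition: the three registered stubs give the target BY NAME.**
`ClauseC 𝓛.gen₀` (split) → `ClauseC (genObf O … C₁ …)` (obfuscation is monotone) →
`ClauseC (genObf O … C₀ …) = ClauseC (𝓛.gen O)` (best-possible step). -/
theorem WbwObfuscatedGluedTrees_of (h₁ : Registered.stub_split)
    (h₂ : Registered.stub_obfuscationMonotone) (h₃ : Registered.stub_bestPossibleStep) :
    KnowledgeTransfer := by
  intro 𝓛 ε O hε hO hadm hcoh hK hW
  obtain ⟨hκc, hκlo, hκhi, hh, ⟨q, hq⟩, hpair, ⟨n₀, hcoins⟩⟩ := hadm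
  have hq₁ : ∃ q : Polynomial ℕ, ∀ s : List Bool, (genClear 𝓛.h 𝓛.m 𝓛.C₁ 𝓛.nm s).length ≤ q.eval s.length :=
    ⟨q, fun s => le_trans (by omega) (hq s)⟩
  have c₁ : ClauseC 𝓛.gen₀ 𝓛.answer := h₁ 𝓛.M 𝓛.gen₀ 𝓛.answer hcoh hK hW
  have c₂ : ClauseC (genObf O 𝓛.κ 𝓛.h 𝓛.m 𝓛.C₁ 𝓛.nm) 𝓛.answer :=
    h₂ O hO.isEfficient 𝓛.κ 𝓛.h 𝓛.m 𝓛.C₁ 𝓛.nm 𝓛.ans hκc hκhi hh hq₁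
      ⟨n₀, fun s hs => (hcoins s hs).2⟩ c₁
  exact h₃ ε O hε hO 𝓛.κ 𝓛.h 𝓛.m 𝓛.C₀ 𝓛.C₁ 𝓛.nm 𝓛.ans hκlo hκhi hh ⟨q, hq⟩ hpair ⟨n₀, hcoins⟩ c₂

/-- **The line's target holds** (all three registered stubs landed): `KnowledgeTransfer`. -/
theorem knowledgeTransfer_holds : KnowledgeTransfer :=
  WbwObfuscatedGluedTrees_of stub_split stub_obfuscationMonotone stub_bestPossibleStep

/-! ## §5 From the target to the crux shape, once `obfuscatedGluedTreesGen` lands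

The corollary isolates exactly what remains at ROUTE level after this line: (a) the definition factors
through line data (definitional), (b) admissibility and coherence (definitional), and (c) the two
generator-specific obligations for the REFERENCE generator — `KnowledgeOfWalk` (KWA₀: a knowledge axiom,
conjecture item) and `WordHard` (WordHard₀: crux item, advantage-neutral) — under the crux's own hypotheses
on `(ε, P, f, c)`.  Nothing here is asserted; it is the re-typing request made precise. -/

/-- `CruxShape obfGen` from `KnowledgeTransfer` and the route-level obligations (proved). -/
theorem cruxShape_of_knowledgeTransfer (hKT : KnowledgeTransfer) (obfGen : GenType)
    (𝓛 : CircuitObfuscator → PuncturablePRFScheme → (List Bool → List Bool) → ℕ → LineData)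
    (hgen : ∀ O P f c, obfGen O P f c = ((𝓛 O P f c).gen O, (𝓛 O P f c).answer))
    (hadm : ∀ ε : ℝ, 0 < ε → ε < 1 → ∀ O : CircuitObfuscator, IsSubexpIO ε ppolyCircuits O →
      ∀ P f c, (𝓛 O P f c).Admissible O)
    (hcoh : ∀ O P f c, Coherent (𝓛 O P f c).M (𝓛 O P f c).gen₀ (𝓛 O P f c).answer)
    (hKW : ∀ ε : ℝ, 0 < ε → ε < 1 → ∀ O : CircuitObfuscator, IsSubexpIO ε ppolyCircuits O →
      ∀ P : PuncturablePRFScheme,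
      IsTDSecurePuncturablePRF P (fun κ => (2 : ℝ) ^ ((κ : ℝ) ^ ε))
        (fun κ => (2 : ℝ) ^ (-((κ : ℝ) ^ ε))) →
      ∀ f : List Bool → List Bool, IsOneWay f → Function.Injective f → ∀ c : ℕ, 1 < (c : ℝ) * ε →
        KnowledgeOfWalk (𝓛 O P f c).M (𝓛 O P f c).gen₀ ∧
          WordHard (𝓛 O P f c).M (𝓛 O P f c).gen₀ (𝓛 O P f c).answer) :
    CruxShape obfGen := by
  intro ε hε hε1 O hO P hP f hf hinj c hc
  obtain ⟨hK, hW⟩ := hKW ε hε hε1 O hO P hP f hf hinj c hc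
  have h := hKT (𝓛 O P f c) ε O hε hO (hadm ε hε hε1 O hO P f c) (hcoh O P f c) hK hW
  rw [hgen]
  exact h

end Summit.QuantumAdvantage.QuantumAdvantage.Cruxes.WbwObfuscatedGluedTrees.KnowledgeOfWalkSplit
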